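import Mathlib
import HarnessLib
import Literature.NumberTheory.LFunctions.ZetaScrew
import Literature.NumberTheory.LFunctions.ZetaScrewThm42Proofs
import Literature.Analysis.SpecialFunctions.EulerMascheroniBounds

/-!
# Suzuki (2023), Theorem 4.1 — `Ψ(t) > 0` for `0 < t < t₀` with some `t₀ > log 2` (proof)

This file DISCHARGES the named fact `Suzuki2023_thm41` of
`Literature/NumberTheory/LFunctions/ZetaScrew.lean`:

`theorem Suzuki2023_thm41_holds : Suzuki2023_thm41`, i.e.
`∃ t₀ > log 2, ∀ t, 0 < t → t < t₀ → 0 < Ψ(t)` for Suzuki's screw function `Ψ = zetaScrew` of `ζ`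
(M. Suzuki, *Aspects of the screw function corresponding to the Riemann zeta-function*,
J. Lond. Math. Soc. (2) 108 (2023) 1448–1487 = arXiv:2206.03682, Theorem 4.1). The statement is
unconditional; in the language of the nested screw matrices of route `IntegerScrew`
(`Summits/RiemannHypothesis/RiemannHypothesis/Theorems/IntegerScrew*.lean`) it says that every
`1 × 1` screw matrix `[2Ψ(t)]` with a node `0 < t ≤ log 2` (and slightly beyond) is positive
definite — the RH-free base of the pivot criterion `RH ↔ ∀ M, d_M > 0`.

## The printed proof and the proof given here

Suzuki's proof (§4.1 of the paper) is computer-assisted: on the prime-free wall `[0, log 2)` the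
derivative `Ψ'` is explicit, it has exactly two zeros `t₁ = 0.152631…`, `t₂ = 0.464002…`, and
`Ψ(0) = 0`, `Ψ(t₂) = 0.0396618… > 0`. We replace the root isolation by a CONVEXITY argument that
needs only three rational evaluations.

On the wall, `Ψ(t) = 8(cosh(t/2) − 1) − (A/2)t + F(t)` with `A = γ₀ + π/2 + 3 log 2 + log π` and
`F(t) = Σ_{k≥0} (1 − e^{−λ_k t})/λ_k²`, `λ_k = 2k + 1/2`
(`Suzuki2023Thm42.zetaScrew_eq_cosh_tsum`, i.e. (1.1) with the Hurwitz–Lerch term summed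
termwise). Termwise differentiation (`hasDerivAt_tsum_of_isPreconnected`, with geometric
majorants on `(t/2, ∞)`) gives, for `t > 0`,

* `Ψ₁(t) := 4 sinh(t/2) − A/2 + Σ_k e^{−λ_k t}/λ_k` with `HasDerivAt Ψ Ψ₁ t` on `(0, log 2)`
  (`hasDerivAt_zetaScrew`; the series sums to `artanh(e^{−t/2}) + arctan(e^{−t/2})`, which is
  Suzuki's closed form — not needed here);
* `Ψ₂(t) := 2 cosh(t/2) − Σ_k e^{−λ_k t} = 2 cosh(t/2) − e^{−t/2}/(1 − e^{−2t})` with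
  `HasDerivAt Ψ₁ Ψ₂ t` (`hasDerivAt_wallPsi₁`, `wallH_eq`).

`Ψ₂` is MONOTONE INCREASING on `(0, ∞)` (`wallPsi₂_monotoneOn`: `cosh` increases, each
`e^{−λ_k t}` decreases), continuous, negative at `2 log(10/9)` and positive at `s := 2 log(5/4)`
(at `t = 2 log a` every exponential is a power of `a⁻¹`, so these are rational computations:
`Ψ₂(2 log a) = a + a⁻¹ − a⁻¹/(1 − a⁻⁴)`). Hence there is an inflection point `c ∈ [2 log(10/9), s]`
with `Ψ₂ ≤ 0` on `(0, c]` and `Ψ₂ ≥ 0` on `[c, ∞)`: `Ψ` is CONCAVE on `[0, c]` and CONVEX on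
`[c, log 2]` (`AntitoneOn.concaveOn_of_deriv`, `MonotoneOn.convexOn_of_deriv`).

* Convex part: `Ψ(t) ≥ Ψ(s) + Ψ₁(s)(t − s)` on `[c, log 2]` (`ConvexOn.le_slope_of_hasDerivAt`,
  `ConvexOn.slope_le_of_hasDerivAt`), and the tangent line is positive on `[0, log 2]` because
  `Ψ(s) ≥ 0.0234` (sixteen terms of `F(s) = Σ_k (1 − (4/5)^{4k+1})/λ_k²`) while
  `−0.0142 ≤ Ψ₁(s) ≤ −0.0122` (five terms of `Σ_k (4/5)^{4k+1}/λ_k` plus a geometric tail) and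
  `log 2 − s ≤ 0.2471`; the constants use the tree's `0.57721558 < γ₀ < 0.57721571`
  (`EulerMascheroniBounds`), Mathlib's `π` and `log 2` to 6/9 digits, `1.144 < log π < 1.1448`
  and `0.22305 < log(5/4) < 0.223211` (proved here from `Real.exp_bound'`,
  `Real.sum_le_exp_of_nonneg`, `Real.abs_log_sub_add_sum_range_le`).
* Concave part: `Ψ(0) = 0` and `Ψ(c) > 0` give `Ψ(t) ≥ (t/c)Ψ(c) > 0` on `(0, c]`.
* Beyond `log 2`: `Ψ(log 2) > 0` and continuity of `Ψ` (`continuous_zetaScrew`) give a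
  neighbourhood of `log 2` on which `Ψ > 0`; `t₀ := log 2 + ε`.

Numerical values for orientation (not used): `c = 0.28120…`, `s = 0.446287…`,
`Ψ(s) = 0.03979…`, `Ψ₁(s) = −0.012738…`, `Ψ(log 2) = 0.0635556…`.

## References

* M. Suzuki, *Aspects of the screw function corresponding to the Riemann zeta-function*,
  J. Lond. Math. Soc. (2) 108 (2023), no. 4, 1448–1487; arXiv:2206.03682, (1.1), Thm 4.1 and its
  proof (§4.1). [Suzuki2023]
-/

noncomputable section

open Filter Set Finset
open scoped Topology BigOperators

namespace Literature.NumberTheory.LFunctions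

namespace Suzuki2023Thm41

/-- The exponents `λ_k = 2k + 1/2` of the wall series. [folklore] -/
def lam (k : ℕ) : ℝ := 2 * k + 1 / 2

/-- `λ_k > 0`. [folklore] -/
private theorem lam_pos (k : ℕ) : 0 < lam k := by unfold lam; positivity

/-- `1/2 ≤ λ_k`. [folklore] -/
private theorem half_le_lam (k : ℕ) : 1 / 2 ≤ lam k := by unfold lam; linarith [(Nat.cast_nonneg k : (0:ℝ) ≤ k)]

/-- The wall series `F(t) = Σ_k (1 − e^{−λ_k t})/λ_k²` (= `¼(C − e^{−t/2}Φ(e^{−2t},2,¼))`). [folklore] -/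
def wallF (t : ℝ) : ℝ := ∑' k : ℕ, (1 - Real.exp (-(lam k * t))) / lam k ^ 2

/-- `F'(t) = G(t) = Σ_k e^{−λ_k t}/λ_k`. [folklore] -/
def wallG (t : ℝ) : ℝ := ∑' k : ℕ, Real.exp (-(lam k * t)) / lam k

/-- `−G'(t) = H(t) = Σ_k e^{−λ_k t} = e^{−t/2}/(1 − e^{−2t})`. [folklore] -/
def wallH (t : ℝ) : ℝ := ∑' k : ℕ, Real.exp (-(lam k * t))

/-- The slope constant `A = γ₀ + π/2 + 3 log 2 + log π` of (1.1). [cite: Suzuki2023, (1.1)] -/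
def wallSlope : ℝ :=
  Real.eulerMascheroniConstant + Real.pi / 2 + 3 * Real.log 2 + Real.log Real.pi

/-- The wall form of `Ψ`: `8(cosh(t/2) − 1) − (A/2)t + F(t)`. [cite: Suzuki2023, proof of Thm 4.1] -/
def wallPsi (t : ℝ) : ℝ := 8 * (Real.cosh (t / 2) - 1) - wallSlope / 2 * t + wallF t

/-- `Ψ'` on the wall: `4 sinh(t/2) − A/2 + G(t)`. [cite: Suzuki2023, proof of Thm 4.1] -/
def wallPsi₁ (t : ℝ) : ℝ := 4 * Real.sinh (t / 2) - wallSlope / 2 + wallG t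

/-- `Ψ''` on the wall: `2 cosh(t/2) − H(t)`. [folklore] -/
def wallPsi₂ (t : ℝ) : ℝ := 2 * Real.cosh (t / 2) - wallH t

/-! ### The wall form of `Ψ` -/

/-- For `0 ≤ t < log 2`: `Ψ(t) = 8(cosh(t/2) − 1) − (A/2)t + F(t)`. [cite: Suzuki2023, proof of Thm 4.1] -/
theorem zetaScrew_eq_wallPsi {t : ℝ} (ht0 : 0 ≤ t) (ht : t < Real.log 2) :
    zetaScrew t = wallPsi t := by
  have habs : |t| = t := abs_of_nonneg ht0
  have h := Suzuki2023Thm42.zetaScrew_eq_cosh_tsum (v := t) (by rwa [habs])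
  rw [habs] at h
  rw [h, wallPsi, wallF, wallSlope]
  simp only [lam]

/-! ### Summability and the geometric closed form of `H` -/

/-- `e^{−λ_k t} = e^{−t/2} · (e^{−2t})^k`. [folklore] -/
private theorem exp_neg_lam_mul (k : ℕ) (t : ℝ) :
    Real.exp (-(lam k * t)) = Real.exp (-(t / 2)) * Real.exp (-(2 * t)) ^ k := by
  rw [← Real.exp_nat_mul, ← Real.exp_add, lam]
  ring_nf

/-- For `t > 0` the terms `e^{−λ_k t}` are summable. [folklore] -/
private theorem summable_exp_neg_lam_mul {t : ℝ} (ht : 0 < t) :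
    Summable fun k : ℕ => Real.exp (-(lam k * t)) := by
  have hr : Real.exp (-(2 * t)) < 1 := by rw [Real.exp_lt_one_iff]; linarith
  simp_rw [exp_neg_lam_mul]
  exact (summable_geometric_of_lt_one (Real.exp_pos _).le hr).mul_left _

/-- For `t > 0`: `H(t) = e^{−t/2}/(1 − e^{−2t})`. [folklore] -/
private theorem wallH_eq {t : ℝ} (ht : 0 < t) :
    wallH t = Real.exp (-(t / 2)) / (1 - Real.exp (-(2 * t))) := by
  have hr : Real.exp (-(2 * t)) < 1 := by rw [Real.exp_lt_one_iff]; linarith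
  rw [wallH]
  simp_rw [exp_neg_lam_mul]
  rw [tsum_mul_left, tsum_geometric_of_lt_one (Real.exp_pos _).le hr]
  simp [div_eq_mul_inv]

/-- The terms `e^{−λ_k t}/λ_k` are summable for `t > 0`. [folklore] -/
private theorem summable_exp_neg_lam_mul_div {t : ℝ} (ht : 0 < t) :
    Summable fun k : ℕ => Real.exp (-(lam k * t)) / lam k := by
  refine (summable_exp_neg_lam_mul ht).mul_right 2 |>.of_norm_bounded fun k => ?_
  rw [Real.norm_eq_abs, abs_of_nonneg (by have := lam_pos k; positivity)]
  rw [div_eq_mul_inv]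
  refine mul_le_mul_of_nonneg_left ?_ (Real.exp_pos _).le
  rw [inv_le_comm₀ (lam_pos k) (by norm_num)]
  have := half_le_lam k
  norm_num at this ⊢
  exact this

/-- The terms `(1 − e^{−λ_k t})/λ_k²` are summable (`t ≥ 0`). [folklore] -/
private theorem summable_wallF_term {t : ℝ} (ht : 0 ≤ t) :
    Summable fun k : ℕ => (1 - Real.exp (-(lam k * t))) / lam k ^ 2 := by
  refine Suzuki2023Thm42.summable_one_div_lam_sq.of_norm_bounded fun k => ?_
  have hlam := lam_pos k
  have h1 : Real.exp (-(lam k * t)) ≤ 1 := by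
    rw [Real.exp_le_one_iff, neg_nonpos]; positivity
  rw [Real.norm_eq_abs, abs_of_nonneg (div_nonneg (sub_nonneg.2 h1) (by positivity))]
  unfold lam at *
  exact div_le_div_of_nonneg_right (by linarith [Real.exp_pos (-((2 * (k:ℝ) + 1 / 2) * t))])
    (by positivity)


/-! ### Derivatives of the wall series (termwise differentiation) -/

/-- `d/dy (1 − e^{−λ_k y})/λ_k² = e^{−λ_k y}/λ_k`. [folklore] -/
private theorem hasDerivAt_wallF_term (k : ℕ) (y : ℝ) :
    HasDerivAt (fun y => (1 - Real.exp (-(lam k * y))) / lam k ^ 2)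
      (Real.exp (-(lam k * y)) / lam k) y := by
  have hne : lam k ≠ 0 := ne_of_gt (lam_pos k)
  have h1 : HasDerivAt (fun y => -(lam k * y)) (-(lam k * 1)) y :=
    ((hasDerivAt_id' y).const_mul (lam k)).fun_neg
  have h2 : HasDerivAt (fun y => Real.exp (-(lam k * y)))
      (Real.exp (-(lam k * y)) * (-(lam k * 1))) y := (Real.hasDerivAt_exp _).comp y h1
  have h3 := ((hasDerivAt_const y (1 : ℝ)).fun_sub h2).div_const (lam k ^ 2)
  refine h3.congr_deriv ?_
  rw [div_eq_div_iff (pow_ne_zero 2 hne) hne]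
  ring

/-- `d/dy e^{−λ_k y}/λ_k = −e^{−λ_k y}`. [folklore] -/
private theorem hasDerivAt_wallG_term (k : ℕ) (y : ℝ) :
    HasDerivAt (fun y => Real.exp (-(lam k * y)) / lam k) (-Real.exp (-(lam k * y))) y := by
  have hne : lam k ≠ 0 := ne_of_gt (lam_pos k)
  have h1 : HasDerivAt (fun y => -(lam k * y)) (-(lam k * 1)) y :=
    ((hasDerivAt_id' y).const_mul (lam k)).fun_neg
  have h2 : HasDerivAt (fun y => Real.exp (-(lam k * y)))
      (Real.exp (-(lam k * y)) * (-(lam k * 1))) y := (Real.hasDerivAt_exp _).comp y h1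
  refine (h2.div_const (lam k)).congr_deriv ?_
  rw [div_eq_iff hne]
  ring

/-- `F' = G` on `(0, ∞)`. [folklore] -/
private theorem hasDerivAt_wallF {t : ℝ} (ht : 0 < t) : HasDerivAt wallF (wallG t) t := by
  have hδ0 : 0 < t / 2 := by positivity
  have hu : Summable fun k : ℕ => 2 * Real.exp (-(lam k * (t / 2))) :=
    (summable_exp_neg_lam_mul hδ0).mul_left 2
  have h := hasDerivAt_tsum_of_isPreconnected (𝕜 := ℝ) (F := ℝ) (t := Set.Ioi (t / 2)) (y₀ := t)
    (g := fun (k : ℕ) (y : ℝ) => (1 - Real.exp (-(lam k * y))) / lam k ^ 2)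
    (g' := fun (k : ℕ) (y : ℝ) => Real.exp (-(lam k * y)) / lam k) hu isOpen_Ioi
    (convex_Ioi (t / 2)).isPreconnected (fun k y _ => hasDerivAt_wallF_term k y) ?_
    (by simp only [Set.mem_Ioi]; linarith) (summable_wallF_term ht.le) (y := t)
    (by simp only [Set.mem_Ioi]; linarith)
  · exact h
  · intro k y hy
    simp only [Set.mem_Ioi] at hy
    have hlam := lam_pos k
    have h2 := half_le_lam k
    rw [Real.norm_eq_abs, abs_of_nonneg (by positivity), div_eq_mul_inv]
    have hexp : Real.exp (-(lam k * y)) ≤ Real.exp (-(lam k * (t / 2))) :=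
      Real.exp_le_exp.mpr (by nlinarith)
    have hinv : (lam k)⁻¹ ≤ 2 := by
      rw [inv_le_comm₀ hlam (by norm_num)]; linarith
    calc Real.exp (-(lam k * y)) * (lam k)⁻¹
        ≤ Real.exp (-(lam k * (t / 2))) * 2 :=
          mul_le_mul hexp hinv (inv_nonneg.mpr hlam.le) (Real.exp_pos _).le
      _ = 2 * Real.exp (-(lam k * (t / 2))) := by ring

/-- `G' = −H` on `(0, ∞)`. [folklore] -/
private theorem hasDerivAt_wallG {t : ℝ} (ht : 0 < t) : HasDerivAt wallG (-wallH t) t := by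
  have hδ0 : 0 < t / 2 := by positivity
  have hu : Summable fun k : ℕ => Real.exp (-(lam k * (t / 2))) := summable_exp_neg_lam_mul hδ0
  have h := hasDerivAt_tsum_of_isPreconnected (𝕜 := ℝ) (F := ℝ) (t := Set.Ioi (t / 2)) (y₀ := t)
    (g := fun (k : ℕ) (y : ℝ) => Real.exp (-(lam k * y)) / lam k)
    (g' := fun (k : ℕ) (y : ℝ) => -Real.exp (-(lam k * y))) hu isOpen_Ioi
    (convex_Ioi (t / 2)).isPreconnected (fun k y _ => hasDerivAt_wallG_term k y) ?_
    (by simp only [Set.mem_Ioi]; linarith) (summable_exp_neg_lam_mul_div ht) (y := t)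
    (by simp only [Set.mem_Ioi]; linarith)
  · rw [tsum_neg] at h
    exact h
  · intro k y hy
    simp only [Set.mem_Ioi] at hy
    have hlam := lam_pos k
    rw [norm_neg, Real.norm_eq_abs, abs_of_nonneg (Real.exp_pos _).le]
    exact Real.exp_le_exp.mpr (by nlinarith)

/-- `Ψ_wall' = Ψ₁` on `(0, ∞)`. [folklore] -/
private theorem hasDerivAt_wallPsi {t : ℝ} (ht : 0 < t) : HasDerivAt wallPsi (wallPsi₁ t) t := by
  have hc : HasDerivAt (fun t : ℝ => Real.cosh (t / 2)) (Real.sinh (t / 2) * (1 / 2)) t :=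
    ((hasDerivAt_id' t).div_const 2).cosh
  have h1 : HasDerivAt (fun t : ℝ => 8 * (Real.cosh (t / 2) - 1))
      (8 * (Real.sinh (t / 2) * (1 / 2))) t := (hc.sub_const 1).const_mul 8
  have h2 : HasDerivAt (fun t : ℝ => wallSlope / 2 * t) (wallSlope / 2 * 1) t :=
    (hasDerivAt_id' t).const_mul (wallSlope / 2)
  have h := (h1.fun_sub h2).fun_add (hasDerivAt_wallF ht)
  have e : wallPsi₁ t = 8 * (Real.sinh (t / 2) * (1 / 2)) - wallSlope / 2 * 1 + wallG t := by
    rw [wallPsi₁]; ring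
  rw [e]
  exact h

/-- `Ψ₁' = Ψ₂` on `(0, ∞)`. [folklore] -/
private theorem hasDerivAt_wallPsi₁ {t : ℝ} (ht : 0 < t) : HasDerivAt wallPsi₁ (wallPsi₂ t) t := by
  have hs : HasDerivAt (fun t : ℝ => Real.sinh (t / 2)) (Real.cosh (t / 2) * (1 / 2)) t :=
    ((hasDerivAt_id' t).div_const 2).sinh
  have h1 : HasDerivAt (fun t : ℝ => 4 * Real.sinh (t / 2) - wallSlope / 2)
      (4 * (Real.cosh (t / 2) * (1 / 2))) t := (hs.const_mul 4).sub_const _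
  have h := h1.fun_add (hasDerivAt_wallG ht)
  have e : wallPsi₂ t = 4 * (Real.cosh (t / 2) * (1 / 2)) + -wallH t := by
    rw [wallPsi₂]; ring
  rw [e]
  exact h

/-- **`Ψ' = Ψ₁` on the open wall `(0, log 2)`.** [cite: Suzuki2023, proof of Thm 4.1] -/
theorem hasDerivAt_zetaScrew {t : ℝ} (ht0 : 0 < t) (ht : t < Real.log 2) :
    HasDerivAt zetaScrew (wallPsi₁ t) t := by
  refine (hasDerivAt_wallPsi ht0).congr_of_eventuallyEq ?_
  filter_upwards [Ioo_mem_nhds ht0 ht] with x hx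
  exact zetaScrew_eq_wallPsi hx.1.le hx.2

/-! ### Monotonicity and continuity of `Ψ₂` -/

/-- `H` is antitone on `(0, ∞)`. [folklore] -/
private theorem wallH_antitoneOn : AntitoneOn wallH (Set.Ioi 0) := by
  intro x hx y hy hxy
  exact Summable.tsum_le_tsum (fun k => Real.exp_le_exp.mpr (by nlinarith [lam_pos k]))
    (summable_exp_neg_lam_mul hy) (summable_exp_neg_lam_mul hx)

/-- `Ψ₂` is monotone on `(0, ∞)` (so `Ψ` is concave-then-convex on the wall). [folklore] -/
private theorem wallPsi₂_monotoneOn : MonotoneOn wallPsi₂ (Set.Ioi 0) := by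
  intro x hx y hy hxy
  have hx0 : 0 < x := hx
  have h1 : Real.cosh (x / 2) ≤ Real.cosh (y / 2) := by
    rw [Real.cosh_le_cosh, abs_of_pos (by linarith), abs_of_pos (by linarith)]
    linarith
  have h2 := wallH_antitoneOn hx hy hxy
  unfold wallPsi₂
  linarith

/-- `Ψ₂` is continuous on `(0, ∞)` (closed form of `H`). [folklore] -/
private theorem continuousOn_wallPsi₂ : ContinuousOn wallPsi₂ (Set.Ioi 0) := by
  have h : ContinuousOn (fun t : ℝ => 2 * Real.cosh (t / 2)
      - Real.exp (-(t / 2)) / (1 - Real.exp (-(2 * t)))) (Set.Ioi 0) := by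
    refine ContinuousOn.sub (Continuous.continuousOn (by fun_prop)) ?_
    refine ContinuousOn.div (Continuous.continuousOn (by fun_prop))
      (Continuous.continuousOn (by fun_prop)) fun x hx => ?_
    have : Real.exp (-(2 * x)) < 1 := by
      rw [Real.exp_lt_one_iff]; simp only [Set.mem_Ioi] at hx; linarith
    linarith
  exact h.congr fun x hx => by rw [wallPsi₂, wallH_eq (Set.mem_Ioi.mp hx)]

/-! ### Special values at `t = 2 log a` (all exponentials rational) -/

/-- `e^{−λ_k · 2 log a} = a^{−(4k+1)}`. [folklore] -/
private theorem exp_neg_lam_mul_two_log {a : ℝ} (ha : 0 < a) (k : ℕ) :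
    Real.exp (-(lam k * (2 * Real.log a))) = a⁻¹ ^ (4 * k + 1) := by
  have : lam k * (2 * Real.log a) = ((4 * k + 1 : ℕ) : ℝ) * Real.log a := by
    push_cast; unfold lam; ring
  rw [this, Real.exp_neg, Real.exp_nat_mul, Real.exp_log ha, inv_pow]

/-- `cosh(log a) = (a + a⁻¹)/2`. [folklore] -/
private theorem cosh_two_log_div_two {a : ℝ} (ha : 0 < a) :
    Real.cosh (2 * Real.log a / 2) = (a + a⁻¹) / 2 := by
  rw [show 2 * Real.log a / 2 = Real.log a by ring, Real.cosh_eq, Real.exp_neg, Real.exp_log ha]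

/-- `sinh(log a) = (a − a⁻¹)/2`. [folklore] -/
private theorem sinh_two_log_div_two {a : ℝ} (ha : 0 < a) :
    Real.sinh (2 * Real.log a / 2) = (a - a⁻¹) / 2 := by
  rw [show 2 * Real.log a / 2 = Real.log a by ring, Real.sinh_eq, Real.exp_neg, Real.exp_log ha]

/-- `H(2 log a) = a⁻¹/(1 − a⁻⁴)` for `a > 1`. [folklore] -/
private theorem wallH_two_log {a : ℝ} (ha : 1 < a) : wallH (2 * Real.log a) = a⁻¹ / (1 - a⁻¹ ^ 4) := by
  have ha0 : 0 < a := by linarith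
  have hlog : 0 < Real.log a := Real.log_pos ha
  rw [wallH_eq (by positivity)]
  have e1 : Real.exp (-(2 * Real.log a / 2)) = a⁻¹ := by
    rw [show -(2 * Real.log a / 2) = -Real.log a by ring, Real.exp_neg, Real.exp_log ha0]
  have e2 : Real.exp (-(2 * (2 * Real.log a))) = a⁻¹ ^ 4 := by
    rw [show -(2 * (2 * Real.log a)) = -(((4 : ℕ) : ℝ) * Real.log a) by push_cast; ring,
      Real.exp_neg, Real.exp_nat_mul, Real.exp_log ha0, inv_pow]
  rw [e1, e2]

/-- `Ψ₂(2 log a) = (a + a⁻¹) − a⁻¹/(1 − a⁻⁴)` for `a > 1`. [folklore] -/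
private theorem wallPsi₂_two_log {a : ℝ} (ha : 1 < a) :
    wallPsi₂ (2 * Real.log a) = (a + a⁻¹) - a⁻¹ / (1 - a⁻¹ ^ 4) := by
  rw [wallPsi₂, cosh_two_log_div_two (by linarith), wallH_two_log ha]; ring

/-- `Ψ₂(2 log(10/9)) < 0` (`= 181/90 − (9/10)/(1 − (9/10)⁴) = −0.6059…`). [folklore] -/
private theorem wallPsi₂_neg_at : wallPsi₂ (2 * Real.log (10 / 9)) < 0 := by
  rw [wallPsi₂_two_log (by norm_num)]; norm_num

/-- `0 ≤ Ψ₂(2 log(5/4))` (`= 41/20 − (4/5)/(1 − (4/5)⁴) = 0.6949…`). [folklore] -/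
private theorem wallPsi₂_nonneg_at : 0 ≤ wallPsi₂ (2 * Real.log (5 / 4)) := by
  rw [wallPsi₂_two_log (by norm_num)]; norm_num

/-- `0 < 2 log(5/4)`. [folklore] -/
private theorem two_log_pos : 0 < 2 * Real.log (5 / 4) := by
  have := Real.log_pos (show (1 : ℝ) < 5 / 4 by norm_num); linarith

/-- The terms of `F(2 log(5/4))`. [folklore] -/
private theorem wallF_term_at (k : ℕ) :
    (1 - Real.exp (-(lam k * (2 * Real.log (5 / 4))))) / lam k ^ 2
      = (1 - (4 / 5 : ℝ) ^ (4 * k + 1)) / (2 * (k : ℝ) + 1 / 2) ^ 2 := by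
  rw [exp_neg_lam_mul_two_log (by norm_num)]; norm_num [lam]

/-- The terms of `G(2 log(5/4))`. [folklore] -/
private theorem wallG_term_at (k : ℕ) :
    Real.exp (-(lam k * (2 * Real.log (5 / 4)))) / lam k
      = (4 / 5 : ℝ) ^ (4 * k + 1) / (2 * (k : ℝ) + 1 / 2) := by
  rw [exp_neg_lam_mul_two_log (by norm_num)]; norm_num [lam]

/-- Partial-sum lower bound for `F(2 log(5/4))` (16 terms). [folklore] -/
private theorem sum_le_wallF_at :
    ∑ k ∈ Finset.range 16, (1 - (4 / 5 : ℝ) ^ (4 * k + 1)) / (2 * (k : ℝ) + 1 / 2) ^ 2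
      ≤ wallF (2 * Real.log (5 / 4)) := by
  have hs := summable_wallF_term two_log_pos.le
  rw [wallF, ← Finset.sum_congr rfl fun k _ => wallF_term_at k]
  refine hs.sum_le_tsum (Finset.range 16) fun k _ => ?_
  have h1 : Real.exp (-(lam k * (2 * Real.log (5 / 4)))) ≤ 1 := by
    rw [Real.exp_le_one_iff, neg_nonpos]; exact mul_nonneg (lam_pos k).le two_log_pos.le
  exact div_nonneg (sub_nonneg.2 h1) (by positivity)

/-- `F(2 log(5/4)) ≥ 1.0226`. [folklore] -/
private theorem wallF_at_ge : (1.0226 : ℝ) ≤ wallF (2 * Real.log (5 / 4)) := by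
  refine le_trans ?_ sum_le_wallF_at
  norm_num [Finset.sum_range_succ]

/-- Partial-sum lower bound for `G(2 log(5/4))` (5 terms). [folklore] -/
private theorem sum_le_wallG_at :
    ∑ k ∈ Finset.range 5, (4 / 5 : ℝ) ^ (4 * k + 1) / (2 * (k : ℝ) + 1 / 2)
      ≤ wallG (2 * Real.log (5 / 4)) := by
  have hs := summable_exp_neg_lam_mul_div two_log_pos
  rw [wallG, ← Finset.sum_congr rfl fun k _ => wallG_term_at k]
  refine hs.sum_le_tsum (Finset.range 5) fun k _ => ?_
  have := lam_pos k
  positivity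

/-- Tail bound: `G(2 log(5/4)) ≤ Σ_{k<5} + (4/5)²¹/(21/2)/(1 − (4/5)⁴)`. [folklore] -/
private theorem wallG_at_le :
    wallG (2 * Real.log (5 / 4)) ≤
      ∑ k ∈ Finset.range 5, (4 / 5 : ℝ) ^ (4 * k + 1) / (2 * (k : ℝ) + 1 / 2)
        + (4 / 5 : ℝ) ^ 21 / (21 / 2) / (1 - (4 / 5) ^ 4) := by
  have hs := summable_exp_neg_lam_mul_div two_log_pos
  rw [wallG, ← hs.sum_add_tsum_nat_add 5, ← Finset.sum_congr rfl fun k _ => wallG_term_at k]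
  refine add_le_add le_rfl ?_
  have hr1 : (4 / 5 : ℝ) ^ 4 < 1 := by norm_num
  have hgeom : Summable fun i : ℕ => (4 / 5 : ℝ) ^ 21 / (21 / 2) * ((4 / 5 : ℝ) ^ 4) ^ i :=
    (summable_geometric_of_lt_one (by norm_num) hr1).mul_left _
  have hterm : ∀ i : ℕ, Real.exp (-(lam (i + 5) * (2 * Real.log (5 / 4)))) / lam (i + 5)
      ≤ (4 / 5 : ℝ) ^ 21 / (21 / 2) * ((4 / 5 : ℝ) ^ 4) ^ i := by
    intro i
    rw [wallG_term_at]
    push_cast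
    have hpow : (4 / 5 : ℝ) ^ (4 * (i + 5) + 1) = (4 / 5 : ℝ) ^ 21 * ((4 / 5 : ℝ) ^ 4) ^ i := by
      rw [← pow_mul, ← pow_add]; ring_nf
    rw [hpow, div_eq_mul_inv, div_eq_mul_inv]
    have hi : (0 : ℝ) ≤ i := Nat.cast_nonneg i
    have hinv : (2 * ((i : ℝ) + 5) + 1 / 2)⁻¹ ≤ (21 / 2 : ℝ)⁻¹ := by
      apply inv_anti₀ (by norm_num); linarith
    have h0 : (0 : ℝ) ≤ (4 / 5 : ℝ) ^ 21 * ((4 / 5 : ℝ) ^ 4) ^ i := by positivity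
    nlinarith
  calc ∑' i : ℕ, Real.exp (-(lam (i + 5) * (2 * Real.log (5 / 4)))) / lam (i + 5)
      ≤ ∑' i : ℕ, (4 / 5 : ℝ) ^ 21 / (21 / 2) * ((4 / 5 : ℝ) ^ 4) ^ i :=
        Summable.tsum_le_tsum hterm ((summable_nat_add_iff 5).mpr hs) hgeom
    _ = (4 / 5 : ℝ) ^ 21 / (21 / 2) * ∑' i : ℕ, ((4 / 5 : ℝ) ^ 4) ^ i := tsum_mul_left
    _ = (4 / 5 : ℝ) ^ 21 / (21 / 2) / (1 - (4 / 5) ^ 4) := by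
        rw [tsum_geometric_of_lt_one (by norm_num) hr1]; ring

/-- `1.772 ≤ G(2 log(5/4)) ≤ 1.7735`. [folklore] -/
private theorem wallG_at_bounds :
    (1.772 : ℝ) ≤ wallG (2 * Real.log (5 / 4)) ∧ wallG (2 * Real.log (5 / 4)) ≤ 1.7735 := by
  constructor
  · refine le_trans ?_ sum_le_wallG_at
    norm_num [Finset.sum_range_succ]
  · refine le_trans wallG_at_le ?_
    norm_num [Finset.sum_range_succ]

/-! ### Numerical constants: `log π`, `log(5/4)`, the slope `A` -/

/-- `log π < 1.1448`. [folklore] -/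
private theorem log_pi_lt : Real.log Real.pi < 1.1448 := by
  rw [Real.log_lt_iff_lt_exp Real.pi_pos]
  have h1 : (1.15578 : ℝ) ≤ Real.exp 0.1448 := by
    have := Real.sum_le_exp_of_nonneg (show (0 : ℝ) ≤ 0.1448 by norm_num) 4
    norm_num [Finset.sum_range_succ, Nat.factorial] at this ⊢
    linarith
  have h2 : Real.exp (1.1448 : ℝ) = Real.exp 1 * Real.exp 0.1448 := by
    rw [← Real.exp_add]; norm_num
  calc Real.pi < 3.141593 := Real.pi_lt_d6
    _ < 2.7182818283 * 1.15578 := by norm_num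
    _ ≤ Real.exp 1 * Real.exp 0.1448 :=
        mul_le_mul Real.exp_one_gt_d9.le h1 (by norm_num) (Real.exp_pos 1).le
    _ = Real.exp 1.1448 := h2.symm

/-- `1.144 < log π`. [folklore] -/
private theorem lt_log_pi : (1.144 : ℝ) < Real.log Real.pi := by
  rw [Real.lt_log_iff_exp_lt Real.pi_pos]
  have h1 : Real.exp (0.144 : ℝ) ≤ 1.15504 := by
    have := Real.exp_bound' (show (0 : ℝ) ≤ 0.144 by norm_num) (show (0.144 : ℝ) ≤ 1 by norm_num)
      (n := 3) (by norm_num)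
    norm_num [Finset.sum_range_succ, Nat.factorial] at this ⊢
    linarith
  have h2 : Real.exp (1.144 : ℝ) = Real.exp 1 * Real.exp 0.144 := by
    rw [← Real.exp_add]; norm_num
  calc Real.exp (1.144 : ℝ) = Real.exp 1 * Real.exp 0.144 := h2
    _ ≤ 2.7182818286 * 1.15504 :=
        mul_le_mul Real.exp_one_lt_d9.le h1 (Real.exp_pos _).le (by norm_num)
    _ < 3.141592 := by norm_num
    _ < Real.pi := Real.pi_gt_d6

/-- `0.22305 < log(5/4) < 0.223211` (five terms of the series of `−log(1 − 1/5)`). [folklore] -/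
private theorem log_five_fourths_bounds :
    (0.22305 : ℝ) < Real.log (5 / 4) ∧ Real.log (5 / 4) < 0.223211 := by
  have h := Real.abs_log_sub_add_sum_range_le (show |(1 / 5 : ℝ)| < 1 by
    rw [abs_of_pos (by norm_num)]; norm_num) 5
  have e : Real.log (1 - 1 / 5 : ℝ) = -Real.log (5 / 4) := by
    rw [show (1 - 1 / 5 : ℝ) = (5 / 4)⁻¹ by norm_num, Real.log_inv]
  rw [e, abs_of_pos (show (0 : ℝ) < 1 / 5 by norm_num)] at h
  norm_num [Finset.sum_range_succ] at h
  rw [abs_le] at h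
  constructor <;> linarith [h.1, h.2]

/-- `5.3714 < A < 5.3723`. [folklore] -/
private theorem wallSlope_bounds : (5.3714 : ℝ) < wallSlope ∧ wallSlope < 5.3723 := by
  have h1 := Literature.Analysis.SpecialFunctions.Real.eulerMascheroniConstant_gt_d8
  have h2 := Literature.Analysis.SpecialFunctions.Real.eulerMascheroniConstant_lt_d8
  have h3 := Real.pi_gt_d6
  have h4 := Real.pi_lt_d6
  have h5 := Real.log_two_gt_d9
  have h6 := Real.log_two_lt_d9
  have h7 := lt_log_pi
  have h8 := log_pi_lt
  unfold wallSlope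
  constructor <;> linarith

/-! ### The three numerical facts used by the convexity argument -/

/-- `2 log(5/4) < log 2`. [folklore] -/
private theorem two_log_lt_log_two : 2 * Real.log (5 / 4) < Real.log 2 := by
  have := log_five_fourths_bounds.2; have := Real.log_two_gt_d9; linarith

/-- `Ψ(2 log(5/4)) ≥ 0.0234`. [folklore] -/
private theorem zetaScrew_at_ge : (0.0234 : ℝ) ≤ zetaScrew (2 * Real.log (5 / 4)) := by
  rw [zetaScrew_eq_wallPsi two_log_pos.le two_log_lt_log_two, wallPsi,
    cosh_two_log_div_two (by norm_num)]
  have hF := wallF_at_ge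
  have hA := wallSlope_bounds
  have hl := log_five_fourths_bounds
  nlinarith [hA.1, hA.2, hl.1, hl.2]

/-- `−0.0142 ≤ Ψ₁(2 log(5/4)) ≤ −0.0122`. [folklore] -/
private theorem wallPsi₁_at_bounds :
    (-0.0142 : ℝ) ≤ wallPsi₁ (2 * Real.log (5 / 4)) ∧ wallPsi₁ (2 * Real.log (5 / 4)) ≤ -0.0122 := by
  rw [wallPsi₁, sinh_two_log_div_two (by norm_num)]
  have hG := wallG_at_bounds
  have hA := wallSlope_bounds
  constructor <;> nlinarith [hG.1, hG.2, hA.1, hA.2]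

/-! ### Assembly: `Ψ` is concave on `[0, c]` and convex on `[c, log 2]`; tangent at `s = 2 log(5/4)` -/

/-- `0 < 2 log(10/9) < 2 log(5/4)`. [folklore] -/
private theorem two_log_ten_ninths_bounds :
    0 < 2 * Real.log (10 / 9) ∧ 2 * Real.log (10 / 9) < 2 * Real.log (5 / 4) := by
  have h1 := Real.log_pos (show (1 : ℝ) < 10 / 9 by norm_num)
  have h2 := Real.log_lt_log (show (0 : ℝ) < 10 / 9 by norm_num) (show (10 / 9 : ℝ) < 5 / 4 by norm_num)
  constructor <;> linarith

/-- `deriv Ψ = Ψ₁` on `(0, log 2)`. [folklore] -/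
private theorem deriv_zetaScrew_eq {t : ℝ} (ht0 : 0 < t) (ht : t < Real.log 2) :
    deriv zetaScrew t = wallPsi₁ t := (hasDerivAt_zetaScrew ht0 ht).deriv

/-- `deriv Ψ₁ = Ψ₂` on `(0, ∞)`. [folklore] -/
private theorem deriv_wallPsi₁_eq {t : ℝ} (ht0 : 0 < t) : deriv wallPsi₁ t = wallPsi₂ t :=
  (hasDerivAt_wallPsi₁ ht0).deriv

/-- `Ψ₁` is continuous on `(0, ∞)`. [folklore] -/
private theorem continuousOn_wallPsi₁ : ContinuousOn wallPsi₁ (Set.Ioi 0) :=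
  fun _ ht => (hasDerivAt_wallPsi₁ ht).continuousAt.continuousWithinAt

/-- `Ψ₁` is differentiable on `(0, ∞)`. [folklore] -/
private theorem differentiableOn_wallPsi₁ : DifferentiableOn ℝ wallPsi₁ (Set.Ioi 0) :=
  fun _ ht => (hasDerivAt_wallPsi₁ ht).differentiableAt.differentiableWithinAt

/-- The inflection point: some `c ∈ [2 log(10/9), 2 log(5/4)]` with `Ψ₂(c) = 0`. [folklore] -/
private theorem exists_wallPsi₂_eq_zero :
    ∃ c : ℝ, 2 * Real.log (10 / 9) ≤ c ∧ c ≤ 2 * Real.log (5 / 4) ∧ wallPsi₂ c = 0 := by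
  have hta := two_log_ten_ninths_bounds
  have hcont : ContinuousOn wallPsi₂ (Set.Icc (2 * Real.log (10 / 9)) (2 * Real.log (5 / 4))) :=
    continuousOn_wallPsi₂.mono fun x hx => lt_of_lt_of_le hta.1 hx.1
  have h := intermediate_value_Icc hta.2.le hcont
  obtain ⟨c, hc, hc0⟩ := h ⟨wallPsi₂_neg_at.le, wallPsi₂_nonneg_at⟩
  exact ⟨c, hc.1, hc.2, hc0⟩

/-- **`Ψ > 0` on `(0, log 2]`** (concavity on `[0, c]` from `Ψ(0) = 0 < Ψ(c)`; convexity on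
`[c, log 2]` and the tangent line at `s = 2 log(5/4)`, which is positive on `[0, log 2]`).
[cite: Suzuki2023, Thm 4.1] -/
theorem zetaScrew_pos_of_le_log_two {t : ℝ} (ht0 : 0 < t) (ht : t ≤ Real.log 2) :
    0 < zetaScrew t := by
  obtain ⟨c, hc1, hc2, hc0⟩ := exists_wallPsi₂_eq_zero
  have hta := two_log_ten_ninths_bounds
  have hc_pos : 0 < c := lt_of_lt_of_le hta.1 hc1
  have hs_pos : 0 < 2 * Real.log (5 / 4) := two_log_pos
  have hsT : 2 * Real.log (5 / 4) < Real.log 2 := two_log_lt_log_two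
  have hcT : c < Real.log 2 := lt_of_le_of_lt hc2 hsT
  -- sign of Ψ₂ on either side of c
  have hΨ₂_nonpos : ∀ x, 0 < x → x ≤ c → wallPsi₂ x ≤ 0 := fun x hx hxc =>
    hc0 ▸ wallPsi₂_monotoneOn hx hc_pos hxc
  have hΨ₂_nonneg : ∀ x, c ≤ x → 0 ≤ wallPsi₂ x := fun x hcx =>
    hc0 ▸ wallPsi₂_monotoneOn hc_pos (lt_of_lt_of_le hc_pos hcx) hcx
  -- convexity on [c, log 2]
  have hconv : ConvexOn ℝ (Set.Icc c (Real.log 2)) zetaScrew := by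
    apply MonotoneOn.convexOn_of_deriv (convex_Icc _ _) continuous_zetaScrew.continuousOn
    · rw [interior_Icc]
      exact fun x hx => (hasDerivAt_zetaScrew (lt_trans hc_pos hx.1)
        hx.2).differentiableAt.differentiableWithinAt
    · rw [interior_Icc]
      have hmono : MonotoneOn wallPsi₁ (Set.Icc c (Real.log 2)) := by
        apply monotoneOn_of_deriv_nonneg (convex_Icc _ _)
        · exact continuousOn_wallPsi₁.mono fun x hx => lt_of_lt_of_le hc_pos hx.1
        · rw [interior_Icc]; exact differentiableOn_wallPsi₁.mono fun x hx => lt_trans hc_pos hx.1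
        · rw [interior_Icc]; intro x hx
          rw [deriv_wallPsi₁_eq (lt_trans hc_pos hx.1)]; exact hΨ₂_nonneg x hx.1.le
      intro x hx y hy hxy
      rw [deriv_zetaScrew_eq (lt_trans hc_pos hx.1) hx.2,
        deriv_zetaScrew_eq (lt_trans hc_pos hy.1) hy.2]
      exact hmono (Set.Ioo_subset_Icc_self hx) (Set.Ioo_subset_Icc_self hy) hxy
  -- concavity on [0, c]
  have hconc : ConcaveOn ℝ (Set.Icc 0 c) zetaScrew := by
    apply AntitoneOn.concaveOn_of_deriv (convex_Icc _ _) continuous_zetaScrew.continuousOn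
    · rw [interior_Icc]
      exact fun x hx => (hasDerivAt_zetaScrew hx.1
        (lt_trans hx.2 hcT)).differentiableAt.differentiableWithinAt
    · rw [interior_Icc]
      have hanti : AntitoneOn wallPsi₁ (Set.Ioo 0 c) := by
        apply antitoneOn_of_deriv_nonpos (convex_Ioo _ _)
        · exact continuousOn_wallPsi₁.mono fun x hx => hx.1
        · rw [interior_Ioo]; exact differentiableOn_wallPsi₁.mono fun x hx => hx.1
        · rw [interior_Ioo]; intro x hx
          rw [deriv_wallPsi₁_eq hx.1]; exact hΨ₂_nonpos x hx.1 hx.2.le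
      intro x hx y hy hxy
      rw [deriv_zetaScrew_eq hx.1 (lt_trans hx.2 hcT), deriv_zetaScrew_eq hy.1 (lt_trans hy.2 hcT)]
      exact hanti hx hy hxy
  -- the tangent line at s = 2 log(5/4) is positive on [0, log 2]
  have hderiv_s := hasDerivAt_zetaScrew hs_pos hsT
  have hval := zetaScrew_at_ge
  have hd := wallPsi₁_at_bounds
  have hTs : Real.log 2 - 2 * Real.log (5 / 4) ≤ 0.2471 := by
    have := Real.log_two_lt_d9; have := log_five_fourths_bounds.1; linarith
  have tangent_pos : ∀ x, x ≤ Real.log 2 →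
      0 < zetaScrew (2 * Real.log (5 / 4)) + wallPsi₁ (2 * Real.log (5 / 4)) *
        (x - 2 * Real.log (5 / 4)) := by
    intro x hxT
    rcases le_or_gt x (2 * Real.log (5 / 4)) with hxs | hxs
    · nlinarith [hd.2]
    · nlinarith [hd.1]
  -- positivity on [c, log 2] by convexity
  have pos_right : ∀ x, c ≤ x → x ≤ Real.log 2 → 0 < zetaScrew x := by
    intro x hcx hxT
    have hxS : x ∈ Set.Icc c (Real.log 2) := ⟨hcx, hxT⟩
    have hsS : 2 * Real.log (5 / 4) ∈ Set.Icc c (Real.log 2) := ⟨hc2, hsT.le⟩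
    have htan := tangent_pos x hxT
    rcases lt_trichotomy x (2 * Real.log (5 / 4)) with hxs | hxs | hxs
    · have h := hconv.slope_le_of_hasDerivAt hxS hsS hxs hderiv_s
      rw [slope_def_field, div_le_iff₀ (by linarith)] at h
      nlinarith
    · rw [hxs]; linarith
    · have h := hconv.le_slope_of_hasDerivAt hsS hxS hxs hderiv_s
      rw [slope_def_field, le_div_iff₀ (by linarith)] at h
      nlinarith
  rcases le_or_gt c t with hct | htc
  · exact pos_right t hct ht
  · -- 0 < t < c: concavity with Ψ(0) = 0 < Ψ(c)
    have hfc : 0 < zetaScrew c := pos_right c le_rfl hcT.le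
    have ha : (0 : ℝ) ≤ 1 - t / c := by rw [sub_nonneg, div_le_one hc_pos]; exact htc.le
    have hb : (0 : ℝ) ≤ t / c := by positivity
    have hab : (1 - t / c) + t / c = 1 := by ring
    have h := hconc.2 (Set.left_mem_Icc.mpr hc_pos.le) (Set.right_mem_Icc.mpr hc_pos.le) ha hb hab
    simp only [smul_eq_mul, mul_zero, zero_add, zetaScrew_zero] at h
    rw [div_mul_cancel₀ t hc_pos.ne'] at h
    have : 0 < t / c * zetaScrew c := mul_pos (div_pos ht0 hc_pos) hfc
    linarith

end Suzuki2023Thm41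

open Suzuki2023Thm41 in
/-- **Suzuki2023 Theorem 4.1** (discharged): there is `t₀ > log 2` with `Ψ(t) > 0` for all
`0 < t < t₀`. Here: `Ψ > 0` on `(0, log 2]` by the concave/convex structure of `Ψ` on the
prime-free wall, and on a neighbourhood of `log 2` by continuity. [cite: Suzuki2023, Thm 4.1] -/
theorem Suzuki2023_thm41_holds : Suzuki2023_thm41 := by
  have hT : 0 < zetaScrew (Real.log 2) :=
    zetaScrew_pos_of_le_log_two (Real.log_pos one_lt_two) le_rfl
  have hev : ∀ᶠ t in 𝓝 (Real.log 2), 0 < zetaScrew t :=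
    continuous_zetaScrew.continuousAt.eventually (lt_mem_nhds hT)
  obtain ⟨ε, hε, hball⟩ := Metric.eventually_nhds_iff.mp hev
  refine ⟨Real.log 2 + ε, by linarith, fun t ht0 ht => ?_⟩
  rcases le_or_gt t (Real.log 2) with h | h
  · exact zetaScrew_pos_of_le_log_two ht0 h
  · apply hball
    rw [Real.dist_eq, abs_lt]
    constructor <;> linarith



/-! ## Appendix: the closed form of `Ψ'` on the wall (Suzuki's formula, with `log π` restored)

`Σ_k e^{−λ_k t}/λ_k = artanh(e^{−t/2}) + arctan(e^{−t/2})` for `t > 0` (`λ_k = 2k + ½`): with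
`y = e^{−t/2}`, `e^{−λ_k t}/λ_k = 2y^{4k+1}/(4k+1)`, and `Σ_k 2y^{4k+1}/(4k+1)` is the even-indexed
part of `Σ_n (1 + (−1)^n) y^{2n+1}/(2n+1) = ½(log(1+y) − log(1−y)) + arctan y` (Mathlib's
`hasSum_log_sub_log_of_abs_lt_one`, `Real.hasSum_arctan`). Hence, for `0 < t < log 2`,
`Ψ'(t) = 4 sinh(t/2) − (γ₀ + π/2 + 3 log 2 + log π)/2 + ½ log((1 + e^{−t/2})/(1 − e^{−t/2})) + arctan(e^{−t/2})`
— the formula printed in the proof of Suzuki2023 Thm 4.1 up to the arrangement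
`arctan(e^{−t/2}) = π/2 − arctan(e^{t/2})` and the `log π` noted in `ZetaScrew.lean`. -/

namespace Suzuki2023Thm41

/-- `e^{−λ_k t} = (e^{−t/2})^{4k+1}`. [folklore] -/
private theorem exp_neg_lam_mul_eq_pow (k : ℕ) (t : ℝ) :
    Real.exp (-(lam k * t)) = Real.exp (-(t / 2)) ^ (4 * k + 1) := by
  rw [← Real.exp_nat_mul]
  congr 1
  push_cast; unfold lam; ring

/-- `Σ_k e^{−λ_k t}/λ_k = ½(log(1 + e^{−t/2}) − log(1 − e^{−t/2})) + arctan(e^{−t/2})` for `t > 0`.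
[cite: Suzuki2023, proof of Thm 4.1] -/
theorem hasSum_wallG {t : ℝ} (ht : 0 < t) :
    HasSum (fun k : ℕ => Real.exp (-(lam k * t)) / lam k)
      ((Real.log (1 + Real.exp (-(t / 2))) - Real.log (1 - Real.exp (-(t / 2)))) / 2
        + Real.arctan (Real.exp (-(t / 2)))) := by
  set y : ℝ := Real.exp (-(t / 2)) with hy
  have hy0 : 0 < y := Real.exp_pos _
  have hy1 : y < 1 := by rw [hy, Real.exp_lt_one_iff]; linarith
  have hyabs : |y| < 1 := by rw [abs_of_pos hy0]; exact hy1
  have hA := (Real.hasSum_log_sub_log_of_abs_lt_one hyabs).div_const 2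
  have hB := Real.hasSum_arctan (x := y) (by rw [Real.norm_eq_abs]; exact hyabs)
  have hsum := hA.add hB
  have key : (fun j : ℕ => Real.exp (-(lam j * t)) / lam j)
      = (fun k : ℕ => 2 * (1 / (2 * (k : ℝ) + 1)) * y ^ (2 * k + 1) / 2
          + (-1) ^ k * y ^ (2 * k + 1) / ((2 * k + 1 : ℕ) : ℝ)) ∘ (fun j : ℕ => 2 * j) := by
    ext j
    simp only [Function.comp_apply]
    rw [exp_neg_lam_mul_eq_pow, ← hy]
    have h1 : ((-1 : ℝ)) ^ (2 * j) = 1 := by rw [pow_mul]; simp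
    rw [h1]
    push_cast
    unfold lam
    have e1 : 2 * (2 * (j : ℝ)) + 1 = 4 * j + 1 := by ring
    have e2 : 2 * (2 * j) + 1 = 4 * j + 1 := by ring
    rw [e1, e2]
    have hne : (4 * (j : ℝ) + 1) ≠ 0 := by positivity
    have hne' : (2 * (j : ℝ) + 1 / 2) ≠ 0 := by positivity
    field_simp
    ring
  rw [key, (mul_right_injective₀ (two_ne_zero' ℕ)).hasSum_iff]
  · exact hsum
  · intro m hm
    rw [range_two_mul, Set.mem_setOf_eq] at hm
    have hodd : Odd m := Nat.not_even_iff_odd.mp hm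
    simp only [hodd.neg_one_pow]
    push_cast
    ring

/-- `G(t) = ½(log(1 + e^{−t/2}) − log(1 − e^{−t/2})) + arctan(e^{−t/2})` for `t > 0`.
[cite: Suzuki2023, proof of Thm 4.1] -/
theorem wallG_eq_closedForm {t : ℝ} (ht : 0 < t) :
    wallG t = (Real.log (1 + Real.exp (-(t / 2))) - Real.log (1 - Real.exp (-(t / 2)))) / 2
      + Real.arctan (Real.exp (-(t / 2))) :=
  (hasSum_wallG ht).tsum_eq

end Suzuki2023Thm41

open Suzuki2023Thm41 in
/-- **Suzuki's closed form of `Ψ'` on the wall** (`0 < t < log 2`), with the `log π` of (1.1):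
`Ψ'(t) = 4 sinh(t/2) − (γ₀ + π/2 + 3 log 2 + log π)/2 + ½(log(1 + e^{−t/2}) − log(1 − e^{−t/2})) + arctan(e^{−t/2})`.
[cite: Suzuki2023, proof of Thm 4.1] -/
theorem hasDerivAt_zetaScrew_wall {t : ℝ} (ht0 : 0 < t) (ht : t < Real.log 2) :
    HasDerivAt zetaScrew
      (4 * Real.sinh (t / 2)
        - (Real.eulerMascheroniConstant + Real.pi / 2 + 3 * Real.log 2 + Real.log Real.pi) / 2
        + ((Real.log (1 + Real.exp (-(t / 2))) - Real.log (1 - Real.exp (-(t / 2)))) / 2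
          + Real.arctan (Real.exp (-(t / 2))))) t := by
  have h := hasDerivAt_zetaScrew ht0 ht
  rwa [wallPsi₁, wallG_eq_closedForm ht0, wallSlope] at h

end Literature.NumberTheory.LFunctions
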